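import Summits.Ventures.PercRepro2.CaseOneStarCertT1
import Summits.Ventures.PercRepro2.CaseOneGadgetUWA1OBlockIQ0
import Summits.Ventures.PercRepro2.CaseOneGadgetUWA1OBlockIQ1
import Summits.Ventures.PercRepro2.CaseOneGadgetUWA1OBlockIQ2
import Summits.Ventures.PercRepro2.CaseOneGadgetUWA1OBlockIQ3
import Summits.Ventures.PercRepro2.CaseOneGadgetUWA1OBlockIQ4
import Summits.Ventures.PercRepro2.CaseOneGadgetUWA1OBlockIQ5
import Summits.Ventures.PercRepro2.CaseOneGadgetUWA1OBlockIQ6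
import Summits.Ventures.PercRepro2.CaseOneGadgetUWA1OBlockIQ7
import Summits.Ventures.PercRepro2.CaseOneGadgetUWA1OBlockIQ8
import Summits.Ventures.PercRepro2.CaseOneGadgetUWA1OBlockIQ9
import Summits.Ventures.PercRepro2.CaseOneGadgetUWA1OBlockIQ10
import Summits.Ventures.PercRepro2.CaseOneGadgetUWA1OBlockIQ11
import Summits.Ventures.PercRepro2.CaseOneGadgetUWA1OBlockIQ12
import Summits.Ventures.PercRepro2.CaseOneGadgetUWA1OBlockIQ13
import Summits.Ventures.PercRepro2.CaseOneGadgetUWA1OBlockIQ14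

/-!
# The gadget `u ~ {w, a₁, o}`, `w ~ {u, a₂, b}` (uwa1o): the cell certificates of `iqAO5` (part 36d)
(blind cell PercRepro2, p1 g34; the fourth gadget anchor of the six-form calculus — all six forms of the uwa1o gadget
as plain SFacts-cone certificate chains, generated by mining/p1/g34/uwa1o/genu.py = p1 g33's gent_uwa1.py / g25's
geno.py re-targeted; P1-G33 §6–§6″, P1-G34)

Each `eBAOIQ ijk kl` is a nonnegative combination of `(pairwise atom) × (cell)` and cubic cell monomials — or, for the degree-4 ones, `M × eBAOIQ ijk kl` (`M = Σ cᵢ` the total cell mass) is a nonnegative combination of `(atom) × (cell) × (cell)` and quartic cell monomials, then `SFacts.nonneg_of_sum_mul` (`CaseOneStarCertT1`) — exact LP certificates (kit j319447, every certificate re-verified exactly; data/p1/g33/gcerts_i_uwa1o.json, form `i-Q`), here as exact `linear_combination`s over `SFacts` (the rational coefficients cleared by their common denominator). -/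

namespace Summit.Ventures.PercRepro2

namespace CaseOne

section CertAOIQ36d
variable {R : Type*} [Field R] [LinearOrder R] [IsStrictOrderedRing R]

set_option maxHeartbeats 0 in
/-- `eBAOIQ33332 ≥ 0`: the combination is identically zero (`ring`). -/
lemma eBAOIQ33332_nonneg (m : SCells R) (_hf : SFacts m) : 0 ≤ eBAOIQ33332 m := by
  have h : eBAOIQ33332 m = 0 := by
    unfold eBAOIQ33332 cBAOIQ00132 cBAOIQ01032 cBAOIQ01132 cBAOIQ01232 cBAOIQ02132 cBAOIQ02232 cBAOIQ02332 cBAOIQ03232 cBAOIQ03332 cBAOIQ10132 cBAOIQ10232 cBAOIQ11032 cBAOIQ11132 cBAOIQ11232 cBAOIQ11332 cBAOIQ12032 cBAOIQ12132 cBAOIQ12232 cBAOIQ12332 cBAOIQ13132 cBAOIQ13232 cBAOIQ13332 cBAOIQ20232 cBAOIQ21132 cBAOIQ21232 cBAOIQ21332 cBAOIQ22032 cBAOIQ22132 cBAOIQ22232 cBAOIQ22332 cBAOIQ23032 cBAOIQ23132 cBAOIQ23232 cBAOIQ23332 cBAOIQ31232 cBAOIQ31332 cBAOIQ32132 cBAOIQ32232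 cBAOIQ32332 cBAOIQ33032 cBAOIQ33132 cBAOIQ33232 cBAOIQ33332
    ring
  linarith [h]

end CertAOIQ36d

end CaseOne

end Summit.Ventures.PercRepro2
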